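import Literature.AnabelianGeometry.SemiGraphs.TemperedPiVirtuallyFreeTower
import Literature.AnabelianGeometry.SemiGraphs.TemperedPiChartExists
import Literature.AnabelianGeometry.SemiGraphs.TemperedChartTransport
import HarnessLib

/-!
# The virtually free tower for EVERY chart of `π₁^temp(𝒢)` ([SemiAnbd] Prop. 3.6, Rmk. 3.2.1)

Mochizuki, *Semi-graphs of anabelioids*, Publ. RIMS **42** (2006) [SemiAnbd], §3 p. 38: the
tempered fundamental group `π₁^temp(𝒢) := lim_i Gal(𝒢_{∞,i}/𝒢)` is "independent, up to inner
automorphism, of the choice" (Prop. 3.2 / Rmk. 3.2.1).  In the tree a *chart* is any tempered group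
`Π` with `B^temp(𝒢) ≌ B^temp(Π)` (`TemperedPiChart`); any two charts are isomorphic as topological
groups (`TemperedPiChart.exists_compatIso`, `TemperedChartTransport.lean`), and Prop. 3.6 (i)(ii)
constructs one (`ProfiniteSemiGraph.temperedPiChart`).  [cite: MochizukiSemiAnbd2006, Prop 3.6 p.38]

PROOF-ONLY file (abc-iut cell, prover abc-iut-w5-d139; no definitions).  It transports the André
tower property `htower₀` ("cofinal open normal `N` with `Π/N ⊇` a free, normal, finite-index,
finite-rank, non-abelian subgroup"), proved AT THE MODEL in `TemperedPiVirtuallyFreeTower.lean`,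
to every chart:

* `tower_of_continuousMulEquiv` — `htower₀` is invariant under isomorphisms of topological groups
  (generic);
* `TemperedPiChart.nonempty_continuousMulEquiv_temperedPi` — every chart's group is isomorphic, as
  a topological group, to the model `𝒢.temperedPi h36`;
* `TemperedPiChart.tower` — **for every chart `c` of a semi-graph of anabelioids with finitely many
  edges satisfying the hypotheses of Prop. 3.6, one of whose Galois levels has non-abelian graph
  fundamental group, `c.G` satisfies `htower₀`** — the form consumed "for every chart" by the §6
  files.

Nothing here concerns the disputed parts of inter-universal Teichmüller theory or takes a side on
[IUTchIII] Cor. 3.12.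
-/

noncomputable section

namespace Literature.AnabelianGeometry.SemiGraphs

open CategoryTheory
open _root_.Topology
open Literature.GroupTheory.CombinatorialGroupTheory

universe u

/-! ### Transport of the tower property along isomorphisms of topological groups -/

section Transport

variable {P P' : Type u} [Group P] [TopologicalSpace P] [Group P'] [TopologicalSpace P']

/-- A free, normal, finite-index, finite-rank, non-abelian subgroup transports along a group
isomorphism of the ambient groups. [cite: MochizukiSemiAnbd2006, Prop 3.6 p.38] -/
theorem exists_free_normal_finiteIndex_of_mulEquiv {A B : Type u} [Group A] [Group B] (e : A ≃* B)
    (h : ∃ (G : Subgroup A) (_ : IsFreeGroup G), G.Normal ∧ G.FiniteIndex ∧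
      Finite (IsFreeGroup.Generators G) ∧ ∃ a ∈ G, ∃ b ∈ G, a * b ≠ b * a) :
    ∃ (G : Subgroup B) (_ : IsFreeGroup G), G.Normal ∧ G.FiniteIndex ∧
      Finite (IsFreeGroup.Generators G) ∧ ∃ a ∈ G, ∃ b ∈ G, a * b ≠ b * a := by
  obtain ⟨G, hG, hGn, hGfi, hGfin, a, ha, b, hb, hab⟩ := h
  refine ⟨G.map (e : A →* B), ?_⟩
  obtain ⟨hfree, hfin⟩ := IsFreeGroup.exists_isFreeGroup_finite_generators_of_mulEquiv
    (e.subgroupMap G) ⟨hG, hGfin⟩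
  refine ⟨hfree, hGn.map _ e.surjective, ⟨?_⟩, hfin, e a, ⟨a, ha, rfl⟩, e b, ⟨b, hb, rfl⟩,
    fun h => hab (e.injective ?_)⟩
  · rw [Subgroup.index_map_equiv]
    exact hGfi.index_ne_zero
  · rw [map_mul, map_mul]
    exact h

/-- **The tower property `htower₀` is invariant under isomorphisms of topological groups**: open
normal subgroups, their cofinality in `𝓝 1`, and the structure of the quotients all transport along
`e : P ≃ₜ* P'`. [cite: MochizukiSemiAnbd2006, Prop 3.6 p.38] -/
theorem tower_of_continuousMulEquiv (e : P ≃ₜ* P')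
    (htower₀ : ∀ U ∈ 𝓝 (1 : P), ∃ N : OpenNormalSubgroup P, (N : Set P) ⊆ U ∧
      ∃ (G : Subgroup (P ⧸ N.toSubgroup)) (_ : IsFreeGroup G), G.Normal ∧ G.FiniteIndex ∧
        Finite (IsFreeGroup.Generators G) ∧ ∃ a ∈ G, ∃ b ∈ G, a * b ≠ b * a) :
    ∀ U ∈ 𝓝 (1 : P'), ∃ N : OpenNormalSubgroup P', (N : Set P') ⊆ U ∧
      ∃ (G : Subgroup (P' ⧸ N.toSubgroup)) (_ : IsFreeGroup G), G.Normal ∧ G.FiniteIndex ∧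
        Finite (IsFreeGroup.Generators G) ∧ ∃ a ∈ G, ∃ b ∈ G, a * b ≠ b * a := by
  intro U' hU'
  -- pull the neighbourhood back to `P`
  have hU : e ⁻¹' U' ∈ 𝓝 (1 : P) := by
    apply e.continuous.continuousAt.preimage_mem_nhds
    simpa using hU'
  obtain ⟨N, hNU, hGN⟩ := htower₀ _ hU
  -- the open normal subgroup `e(N) = e.symm⁻¹(N)` of `P'`
  haveI : N.toSubgroup.Normal := N.isNormal'
  let N' : OpenNormalSubgroup P' :=
    { toSubgroup := N.toSubgroup.comap (e.symm : P' →* P)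
      isOpen' := N.toOpenSubgroup.isOpen.preimage e.symm.continuous
      isNormal' := inferInstance }
  refine ⟨N', fun x hx => ?_, ?_⟩
  · have h1 : e.symm x ∈ e ⁻¹' U' := hNU hx
    simpa using h1
  · -- `P'/N' ≅ P/N`
    haveI : N'.toSubgroup.Normal := N'.isNormal'
    have he : N'.toSubgroup.map (e.symm : P' ≃* P) = N.toSubgroup :=
      Subgroup.map_comap_eq_self_of_surjective e.symm.surjective _
    let ē : P' ⧸ N'.toSubgroup ≃* P ⧸ N.toSubgroup :=
      QuotientGroup.congr N'.toSubgroup N.toSubgroup (e.symm : P' ≃* P) he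
    exact exists_free_normal_finiteIndex_of_mulEquiv ē.symm hGN

end Transport

/-! ### Every chart -/

namespace ProfiniteSemiGraph

variable {𝒢 : ProfiniteSemiGraph.{u}}

/-- **Every chart is isomorphic, as a topological group, to the model** `𝒢.temperedPi h36`
(Prop. 3.2 / Rmk. 3.2.1 through `TemperedPiChart.exists_compatIso`).
[cite: MochizukiSemiAnbd2006, Prop 3.6(ii) p.38] -/
theorem TemperedPiChart.nonempty_continuousMulEquiv_temperedPi (c : TemperedPiChart 𝒢)
    (h36 : 𝒢.Prop36Hypotheses) : Nonempty (𝒢.temperedPi h36 ≃ₜ* c.G) := by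
  obtain ⟨φ, ψ, hψφ, hφψ, -, -⟩ := TemperedPiChart.exists_compatIso (𝒢.temperedPiChart h36) c
  exact ⟨⟨⟨⟨φ, ψ, hψφ, hφψ⟩, fun x y => map_mul φ x y⟩, φ.continuous, ψ.continuous⟩⟩

/-- **The virtually free tower for EVERY chart of `π₁^temp(𝒢)`** ([André 2003] §4.5 / [SemiAnbd]
Prop. 3.6 at all charts): for a semi-graph of anabelioids `𝒢` with finitely many edges satisfying
the hypotheses of Prop. 3.6, one of whose Galois levels `𝒢_n` has non-abelian graph fundamental group
`π₁(𝔾_n, [x_n])`, the group `c.G` of every tempered fundamental group chart `c` has cofinally many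
open normal subgroups `N` with `c.G/N` containing a free, normal, finite-index, finite-rank,
non-abelian subgroup (transport of `ProfiniteSemiGraph.temperedPi_tower` along
`nonempty_continuousMulEquiv_temperedPi`). [cite: MochizukiSemiAnbd2006, Prop 3.6 p.38] -/
theorem TemperedPiChart.tower (c : TemperedPiChart 𝒢) (h36 : 𝒢.Prop36Hypotheses)
    [Finite 𝒢.graph.Edge]
    (hnonab : ∃ (n : ℕ) (a b : ((𝒢.galoisLevelData h36).S n).orbitGraph.FundamentalGroup
      (((𝒢.galoisLevelData h36).S n).baseComp (𝒢.galoisLevelData h36).v₀ ((𝒢.galoisLevelData h36).x n))),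
      a * b ≠ b * a) :
    ∀ U ∈ 𝓝 (1 : c.G), ∃ N : OpenNormalSubgroup c.G, (N : Set c.G) ⊆ U ∧
      ∃ (G : Subgroup (c.G ⧸ N.toSubgroup)) (_ : IsFreeGroup G), G.Normal ∧ G.FiniteIndex ∧
        Finite (IsFreeGroup.Generators G) ∧ ∃ a ∈ G, ∃ b ∈ G, a * b ≠ b * a := by
  obtain ⟨e⟩ := c.nonempty_continuousMulEquiv_temperedPi h36
  exact tower_of_continuousMulEquiv e (𝒢.temperedPi_tower h36 hnonab)

end ProfiniteSemiGraph

end Literature.AnabelianGeometry.SemiGraphs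

end
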